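import Literature.MathematicalPhysics.QuantumFieldTheory.Balaban1983to89.Node00.Record12BgRowCoClassGaugeRGuardedB
import Literature.MathematicalPhysics.QuantumFieldTheory.Balaban1983to89.Node00.Record12BgRowCoClassCPMFloorB

/-!
# NODE 00 — ROW P11's BODY OVER A **BOND-LEVEL DETERMINING DATUM** AND A **TOP-DATA PREDICATE**: the `(bd, Dat)` twins of `Record12BgRowCoClassGaugeRGuarded` §2 ∕ §3 ∕ §5 — the row body for
# every `bd`-minimiser, the row body for ANY background standing in the «minimiser-or-junk-`1`» dichotomy (node00-def-R's `UbgMSCoPOfRecord` today at reading (b), after Stage 2 at print's datum),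
# and the Stage-13 lift with the guard as an inner antecedent

Cell `pub-ymgap`, seat `pub-ymgap-k0-s1-w1` g9 (K0⁷ **stmt-QuantumFields-20541** helper lane; (E1)∕(iii-b) work plan WORKPLAN-IIIB 27c850bec22d4efe — the «row-body sequel» of rows
S1a-C ∕ S1b-2 (CLAIM BOARD v7 00dff90072551ccd; dag-n07-w2 g7 CLAIM S1b-2 «NOT in S1b-2: the ROW BODIES … a sequel `…GaugeRGuardedBRow`»); director-ym №338 (GO on the additive stages) ∕
№339 (ruling (α)); FLAG №16 ∕ LOCATE-HSEAM 5d3298b8d191f169; kernel road-scan ROADSCAN-IIIB-g9 53ea8804079dcb1a: `bgRowAtDatumU_of_thm1RegSepTop7MG_of_thm1GaugeG`,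
`bgRowAtDatumCoP_of_thm1RegSepCoP7MG_of_thm1GaugeG` and the Stage-13 lift's consumer lie on the K0⁷ body's road).  `--kind proof` ∕ `definition` lane as the gate files it
(`--supports stmt-QuantumFields-20541`; count-neutral).  THEOREMS ONLY (0 `def`, 0 `sorry`).  [15] = [Balaban1985Variational]; [6] = [Balaban1985RegularSpaces];
[II] = [Balaban1984PropagatorsII]; [III] = [Balaban1988Convergent]; [I] = [Balaban1987RG1]; [IV] = [Balaban1989LargeFieldI].

HONESTY GUARD (№338 (5)).  PURELY ADDITIVE: print-datum twin ∕ parametrisation of `Node00/Record12BgRowCoClassGaugeRGuarded` §2, §3, §5 (FLAG №16 ∕ LOCATE-HSEAM 5d3298b8d191f169);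
the (b)-instances `bgRowAtDatumU_of_thm1RegSepTop7MG_of_thm1GaugeG`, `bgRowAtDatumCoP_of_thm1RegSepCoP7MG_of_thm1GaugeG`, `Stage13Params.bgAtDatumCoP_of_thm1RegSepCoP7MG_of_thm1GaugeG`
stay landed and true on their own text; NOTHING in that module is edited; no displayed premise is deleted or weakened — the minimiser's datum and the data row become the PARAMETERS
`(bd, Dat)`, and where the (b)-road reads node00-def-R's background THROUGH its (b)-spec (`isMinimizer_UbgMSCoPOfRecord` ∕ `UbgMSCoPOfRecord_eq_one_of_not_mem`), the twin DISPLAYS that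
spec as the ONE hypothesis `hbg` («on every prefix the background is a `bd`-minimiser over the class of record, or the junk value `1`»): discharged TODAY at `bd := genSetDatum F` by the
landed (b)-spec (§2 `ubgMSCoPOfRecord_dichotomy_genSetDatum`), and after the (iii-b) Stage-2 re-point at `bd := lamDatum F` by the restated spec — the twin itself does not wait.

WHY (LOCATE-HSEAM (γ); director-ym №339 (α); E1-IMPACT-CENSUS 53a7b53fbfeb733d (iii)).  Row P11's body of record (the `bg` row of `Provisos₁₃SepCoP`) is proved for node00-def-R's
collar-class background `UbgMSCoPOfRecord … s 𝐖` from the two guarded [15] sentences — (8) `VariationalThm1RegSepCoP7MG` and (9) line 1 `VariationalThm1GaugeRegSepCoP7MG` — both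
quantifying over `IsMinimizer … (genSet s.Ω k) W U₀`, i.e. [III] (2.12) on the READING-(b) fibre; print's Theorem 1 is about the minimiser on the [II] (2.3) fibre «Λ_j = Ω_j^{(j)} ∖
Ω_{j+1}^{(j)} … for the sets of sites and the sets of bonds» (p. 224, the DIFFERENCE of the bond sets — ruling (α)).  S1a-C (`Record12BgRowCoClassCPMFloorB`) and S1b-2
(`Record12BgRowCoClassGaugeRGuardedB`) made the two sentences instances of `(bd, Dat)`-parametrised ones; this file threads `(bd, Dat)` through the three ROW lemmas.  The U₀-generic
row (§1) and the dichotomy form (§2) need no background object at all; the Stage-13 lift (§3) takes the background MAP as a parameter with its `bd`-spec displayed, so the K0⁷ road's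
next link (`Thm/K0AllTorusOfStepTokensGuarded` §1′) re-keys by ONE instantiation whichever way Stage 2 lands (in place or as the new `UbgMSCoPOfRecordB`).

WHAT IS PROVED (sorry-free; proofs = `Record12BgRowCoClassGaugeRGuarded`'s terms with the B names).
* §1 ★★★ `bgRowAtDatumU_of_thm1RegSepTop7MGB_of_thm1GaugeGB` — row P11's body at `(s, 𝐖)` for EVERY `bd`-minimiser `U₀` over the top-domain class (6), from
  `VariationalThm1RegSepTop7MGB … Adm bd Dat …` (S1a-C) and `VariationalThm1GaugeRegSepTop7MGB … M Adm bd Dat …` (S1b-2) at a prefix passing the guard, data row `Dat …`; closing term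
  node00-def-P11's datum-free `bgRowAtDatumU_of_classBoundsPos_of_localGauge`.
* §2 ★★★ `bgRowAtDatumBg_of_thm1RegSepCoP7MGB_of_thm1GaugeGB` — the `CoP` edition for ANY configuration `U` standing in the dichotomy «`bd`-minimiser over `regMSCoPOfRecord` at `𝐖`, or
  `U = 1`» (off the solvable set the junk `1` is row-regular: `bgRowAtDatum_one`); `ubgMSCoPOfRecord_dichotomy_genSetDatum` (node00-def-R's background satisfies it TODAY at the
  (b)-datum, any `𝐖`); ★ `bgRowAtDatumCoP_of_thm1RegSepCoP7MGB_of_thm1GaugeGB_genSetDatum` (hence GaugeRGuarded §3's ★★★ for EVERY data predicate `Dat`, at `bd := genSetDatum F`).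
* §3 ★ `Stage13Params.bgAtDatumBg_of_thm1RegSepCoP7MGB_of_thm1GaugeGB` — the Stage-13 lift (GaugeRGuarded §5) over `(bd, Dat)` and BACKGROUND-GENERIC (`Ubg p n s W` a parameter, its
  `bd`-spec dichotomy `hbg` displayed per prefix); ★ `Stage13Params.bgAtDatumCoP_of_thm1RegSepCoP7MGB_of_thm1GaugeGB_genSetDatum` (today's instance at `UbgMSCoPOfRecord` and `genSetDatum`:
  `hbg` discharged, any `Dat` — GaugeRGuarded §5 is its further instance `Dat := dataSmall7PTopOf F N`).
NOT HERE: node00-def-R's Stage-2 re-point and its restated spec (their pen; it discharges `hbg` at `lamDatum`), the Summits-side consumers `Thm/K0AllTorusOfStepTokensGuarded(ZB)′` (S3),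
the (7) predicate of the print datum (§7′ `Record12BgRowMixedDataB`, plugged in as `Dat` by the V23 texts), any CONCRETE guard or datum.
HONEST SCOPE.  Hypothesis threading around NAMED FACTS (`Prop`s with parameters, NEVER asserted) + one `by_cases`; nothing of [15] ∕ [6] ∕ [III] asserted or discharged; no
(b)-instance statement is claimed false; `stub_prop8StepCoPGridG13` ∕ K0⁷ NOT closed; N07 NOT discharged; counts unmoved (typed 28∕28 · discharged 8∕28); one finite `𝕋⁴` family at
fixed `ε` — the route closes the conditional finite-𝕋⁴ rung `BalabanLadder.UV` only; NOT continuum ∕ ℝ⁴ ∕ OS; the Yang–Mills mass gap (Clay) is NOT proved by any of this.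
No `def`, no `instance`, no `notation`, no `sorry`.

References: [15] (1)–(2) p.277–278, (6)–(7) p.278, Thm 1 (8)–(9) p.279, (144)–(152) pp.300–301, Prop. 8 p.304, p.304 lines 1–2; [6] (1.3)–(1.9) p.77, Prop. 6 p.99; [II] (2.3)
p.224; [III] Thm 1 p.262, (2.4)–(2.8) pp.255–256, (2.10)–(2.13) p.256, (2.27)–(2.28) p.259, (2.34)–(2.41) p.261; [I] (0.1) p.251, (1.11)–(1.16) p.262; [IV] (0.3)–(0.4) p.176.
-/

noncomputable section

open MeasureTheory
open scoped Matrix.Norms.L2Operator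

namespace Literature.MathematicalPhysics.QuantumFieldTheory.Balaban1983to89.Node00

open T4Continuum B14.Eq218Concrete B15DeterminingSets B15DeterminingSetsB B12RegularSpaces111 B14RegularSpaces234 B14Radii T4AxialGaugeSmallField

/-! ## §1  Row P11's body for every `bd`-minimiser over the top-domain class (GaugeRGuarded §2 over `(bd, Dat)`) -/

section RowBodyGaugeGB

variable {F : T4Family} {N : ℕ} [NeZero N]

/-- **★★★ ROW P11's BODY AT `(s, 𝐖)` FOR EVERY `bd`-MINIMISER `U₀` OVER THE TOP-DOMAIN CLASS (6), FROM THE GUARDED (8)-SENTENCE `VariationalThm1RegSepTop7MGB … Adm bd Dat …` (S1a-C)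
AND THE GUARDED GAUGE SENTENCE `VariationalThm1GaugeRegSepTop7MGB … M Adm bd Dat …` (S1b-2), AT A PREFIX PASSING THE GUARD (`hadm : Adm ν M g K k s`), FOR DATA SATISFYING `Dat`** —
`Record12BgRowCoClassGaugeRGuarded.bgRowAtDatumU_of_thm1RegSepTop7MG_of_thm1GaugeG` with the data row `Dat …` and the minimiser row `IsMinimizerB … (bd K k s.Ω) W U₀`; the two
applications re-sourced to `plaqSmallOn_of_thm1RegSepTop7MGB` (S1a-C) and `localGaugeOn_of_thm1GaugeRegSepTop7MGB` (S1b-2); closing term node00-def-P11's datum-free FILE 14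
`bgRowAtDatumU_of_classBoundsPos_of_localGauge`, byte-identical.  ONE guard serves both sentences; ONE `(bd, Dat)` serves both.  Print-datum parametrisation (FLAG №16 ∕ LOCATE-HSEAM
5d3298b8d191f169); the (b)-instance stays landed and true on its own text. [cite: Balaban1985Variational, Thm 1 (2),(6)–(9) pp.278–279, p.304 lines 1–2; Balaban1985RegularSpaces, (1.3)–(1.9) p.77; Balaban1984PropagatorsII, (2.3) p.224; Balaban1988Convergent, (2.4)–(2.8) pp.255–256, (2.10)–(2.13) p.256, (2.27)–(2.28) p.259, (2.34)–(2.41) p.261; Balaban1987RG1, (0.1) p.251, (1.11)–(1.16) p.262] -/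
theorem bgRowAtDatumU_of_thm1RegSepTop7MGB_of_thm1GaugeGB {Sup : (ν : Stage7Numerics) → (K : ℕ) → (ℕ → Set (Site (F.P K) 0)) → Set (Site (F.P K) 0)} {M : ℕ} {Adm : StepGuard F}
    {bd : BondDatum F} {Dat : TopData F N} {B₃ B₃' a₀ a₁ : ℝ} (h15 : VariationalThm1RegSepTop7MGB F N Sup Adm bd Dat B₃ a₀ a₁)
    (h15G : VariationalThm1GaugeRegSepTop7MGB F N Sup M Adm bd Dat B₃ B₃' a₀ a₁)
    (S : Sect2.Setting (MatA N) (SU N)) (hι : S.ι = ιSU N) (h𝓜 : S.𝓜 = B12RegularSpaces111SpecialUnitary.suModel N) (hS : S.Laws) (hpos : S.Pos)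
    (ν : Stage7Numerics) (hM : 0 < M) (K k : ℕ) (cR : ℝ)
    (hnum : ∀ n, n ≤ k → 0 < cR * epsOfRecord ν S.flow.g n ∧ cR * epsOfRecord ν S.flow.g n ≤ a₁ ∧ B₃ * (cR * epsOfRecord ν S.flow.g n) ≤ ν.εreg)
    (ha₀ : ν.εreg ≤ a₀) (hcomp : ∀ n, n < k → cR * epsOfRecord ν S.flow.g n ≤ 2 * (cR * epsOfRecord ν S.flow.g (n + 1)))
    (hcomp' : ∀ n, n < k → cR * epsOfRecord ν S.flow.g (n + 1) ≤ 2 * (cR * epsOfRecord ν S.flow.g n))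
    (hα : ∀ n, 1 ≤ n → n ≤ k → 0 < S.lf.alpha0 (S.flow.g n) ∧ 0 < S.lf.alpha1 (S.flow.g n))
    (hBα : ∀ n, 1 ≤ n → n ≤ k → B₃ * (cR * epsOfRecord ν S.flow.g n) ≤ (1 - S.βc) * S.lf.alpha0 (S.flow.g n))
    (htI : ∀ n, 1 ≤ n → n ≤ k → B₃' * (cR * epsOfRecord ν S.flow.g n) ≤ S.cB * S.lf.alpha0 (S.flow.g n))
    (htMS : ∀ n, 1 ≤ n → n ≤ k → B₃' * (cR * epsOfRecord ν S.flow.g n) ≤ S.B * S.C * S.Mr * S.lf.alpha0 (S.flow.g n))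
    (hC1 : ∀ j, 1 ≤ j → j ≤ k → ∃ t : ℕ, 0 < t ∧ RkOfRecord (F.P K).L ν.r (S.flow.g j) = (F.P K).L * t)
    (hC2 : ∀ j, 1 ≤ j → j ≤ k → dCubeSide (F.P K).L M (RkOfRecord (F.P K).L ν.r (S.flow.g j)) j ∣ (F.P K).sitesPerDir 0)
    (hsN : ∀ n, 1 ≤ n → n ≤ k + 1 → ((B14.Eq213MaximalDomains.side (F.P K).L M n : ℕ) : ℤ) < (F.P K).sitesPerDir 0)
    (s : SeqOfRecord F ν M S.flow.g K k) (hsep : Sect2.SeqSeparated ν.M₁ s) (hM₁ : 0 < ν.M₁) (hadm : Adm ν M S.flow.g K k s) {W : MSField (F.P K) (SU N)}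
    (h7 : Dat K s.Ω (Sup ν K s.Ω) k (fun n => cR * epsOfRecord ν S.flow.g n) W)
    {U₀ : GaugeField (F.P K) 0 (SU N)} (hmin : IsMinimizerB (avOfRecord F N K)
      {U | (∀ n, n ≤ k → PlaqSmallOn (Sect2.omegaPlaqsTop s.Ω (Sup ν K s.Ω) n) (ν.εreg * (F.P K).eta n ^ 2) U) ∧
        Sect2.CoDivClassOnTop s.Ω (Sup ν K s.Ω) k ν.εreg U} (bd K k s.Ω) W U₀) :
    ∀ j, 1 ≤ j → j ≤ k → ∀ X : (Sect2.domSys (F.P K) M j).Dom,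
      (Sect2.domSites (F.P K) M j X ⊆ s.Λ j →
        Sect2.ofBackgroundC S.ι (U₀) ∈
          Sect2.spaceI S (Sect2.Residual.unit (F.P K) (MatA N)) M j (Sect2.domSites (F.P K) M j X) (S.lf.alpha0 (S.flow.g j)) (S.lf.alpha1 (S.flow.g j))) ∧
      (Sect2.admB (F.P K) ν M S.flow.g s.Ω s.Λ j (Sect2.domSites (F.P K) M j X) = true →
        Sect2.ofBackgroundC S.ι (U₀) ∈
          Sect2.spaceMS S (Sect2.Residual.unit (F.P K) (MatA N)) M j (Sect2.domSites (F.P K) M j X) s.Ω) := by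
  have hplaq := plaqSmallOn_of_thm1RegSepTop7MGB h15 ν M S.flow.g K k cR s hsep hM₁ hadm hnum ha₀ hcomp hcomp' h7 hmin
  have hclass : ∀ n, 1 ≤ n → n ≤ k → PlaqSmallOn (omegaPlaqs s.Ω n) (B₃ * (cR * epsOfRecord ν S.flow.g n) * (F.P K).eta n ^ 2) U₀ := by
    intro n hn1 hnk
    have := hplaq n hnk
    rwa [Sect2.omegaPlaqsTop_of_ne_zero _ _ (Nat.one_le_iff_ne_zero.mp hn1)] at this
  have hg := localGaugeOn_of_thm1GaugeRegSepTop7MGB h15G ν S.flow.g K k cR s hsep hM₁ hadm hnum ha₀ hcomp hcomp' h7 hmin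
  exact bgRowAtDatumU_of_classBoundsPos_of_localGauge S hι h𝓜 hS hpos ν hM K k s U₀ hclass hα hBα htI htMS hC1 hC2
    (fun n hn1 hnk => (hg n hn1 hnk).1 (hsN n hn1 (by omega))) (fun n hn1 hnk => (hg n hn1 hnk).2 (hsN (n + 1) (by omega) (by omega)))

end RowBodyGaugeGB

/-! ## §2  The `CoP` edition for any background in the «`bd`-minimiser or junk `1`» dichotomy (GaugeRGuarded §3 over `(bd, Dat)`, background-generic) -/

section AtRecordGaugeCoPMGB

variable {F : T4Family} {N : ℕ} [NeZero N]

/-- **★★★ ROW P11's BODY AT `(s, 𝐖)` FOR ANY CONFIGURATION `U` THAT IS EITHER A `bd`-MINIMISER OVER THE CLASS OF RECORD `regMSCoPOfRecord … s.Ω` AT `𝐖` OR THE JUNK VALUE `1`, FROM THE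
GUARDED (8) `CoP` SENTENCE `VariationalThm1RegSepCoP7MGB … Adm bd Dat …` AND THE GUARDED GAUGE `CoP` SENTENCE `VariationalThm1GaugeRegSepCoP7MGB … M Adm bd Dat …`, AT A PREFIX PASSING
THE GUARD** — `Record12BgRowCoClassGaugeRGuarded.bgRowAtDatumCoP_of_thm1RegSepCoP7MG_of_thm1GaugeG` over `(bd, Dat)` with node00-def-R's background ABSTRACTED to its spec dichotomy `hU`
(the (b)-road's `by_cases hsol` on `isMinimizer_UbgMSCoPOfRecord` ∕ `UbgMSCoPOfRecord_eq_one_of_not_mem` is exactly an inhabitant of `hU` at `bd := genSetDatum F`,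
`ubgMSCoPOfRecord_dichotomy_genSetDatum`): in the minimiser case §1, in the junk case `bgRowAtDatum_one`. [cite: Balaban1985Variational, Thm 1 (2),(6)–(9) pp.278–279, p.304 lines 1–2; Balaban1984PropagatorsII, (2.3) p.224; Balaban1988Convergent, p.255, (2.6)–(2.8) pp.255–256, (2.12)–(2.13) p.256, (2.27)–(2.28) p.259, (2.34)–(2.41) p.261; Balaban1989LargeFieldI, (1.33) p.183; Balaban1987RG1, (0.1) p.251, (1.11)–(1.16) p.262] -/
theorem bgRowAtDatumBg_of_thm1RegSepCoP7MGB_of_thm1GaugeGB {M : ℕ} {Adm : StepGuard F} {bd : BondDatum F} {Dat : TopData F N} {B₃ B₃' a₀ a₁ : ℝ}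
    (h15 : VariationalThm1RegSepCoP7MGB F N Adm bd Dat B₃ a₀ a₁) (h15G : VariationalThm1GaugeRegSepCoP7MGB F N M Adm bd Dat B₃ B₃' a₀ a₁)
    (S : Sect2.Setting (MatA N) (SU N)) (hι : S.ι = ιSU N) (h𝓜 : S.𝓜 = B12RegularSpaces111SpecialUnitary.suModel N) (hS : S.Laws) (hpos : S.Pos)
    (ν : Stage7Numerics) (hM : 0 < M) (K k : ℕ) (cR : ℝ)
    (hnum : ∀ n, n ≤ k → 0 < cR * epsOfRecord ν S.flow.g n ∧ cR * epsOfRecord ν S.flow.g n ≤ a₁ ∧ B₃ * (cR * epsOfRecord ν S.flow.g n) ≤ ν.εreg)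
    (ha₀ : ν.εreg ≤ a₀) (hcomp : ∀ n, n < k → cR * epsOfRecord ν S.flow.g n ≤ 2 * (cR * epsOfRecord ν S.flow.g (n + 1)))
    (hcomp' : ∀ n, n < k → cR * epsOfRecord ν S.flow.g (n + 1) ≤ 2 * (cR * epsOfRecord ν S.flow.g n))
    (hα : ∀ n, 1 ≤ n → n ≤ k → 0 < S.lf.alpha0 (S.flow.g n) ∧ 0 < S.lf.alpha1 (S.flow.g n))
    (hBα : ∀ n, 1 ≤ n → n ≤ k → B₃ * (cR * epsOfRecord ν S.flow.g n) ≤ (1 - S.βc) * S.lf.alpha0 (S.flow.g n))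
    (htI : ∀ n, 1 ≤ n → n ≤ k → B₃' * (cR * epsOfRecord ν S.flow.g n) ≤ S.cB * S.lf.alpha0 (S.flow.g n))
    (htMS : ∀ n, 1 ≤ n → n ≤ k → B₃' * (cR * epsOfRecord ν S.flow.g n) ≤ S.B * S.C * S.Mr * S.lf.alpha0 (S.flow.g n))
    (hC1 : ∀ j, 1 ≤ j → j ≤ k → ∃ t : ℕ, 0 < t ∧ RkOfRecord (F.P K).L ν.r (S.flow.g j) = (F.P K).L * t)
    (hC2 : ∀ j, 1 ≤ j → j ≤ k → dCubeSide (F.P K).L M (RkOfRecord (F.P K).L ν.r (S.flow.g j)) j ∣ (F.P K).sitesPerDir 0)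
    (hsN : ∀ n, 1 ≤ n → n ≤ k + 1 → ((B14.Eq213MaximalDomains.side (F.P K).L M n : ℕ) : ℤ) < (F.P K).sitesPerDir 0)
    (s : SeqOfRecord F ν M S.flow.g K k) (hsep : Sect2.SeqSeparated ν.M₁ s) (hM₁ : 0 < ν.M₁) (hadm : Adm ν M S.flow.g K k s) (W : MSField (F.P K) (SU N))
    (h7 : Dat K s.Ω (suppDomOfRecord F ν K s.Ω) k (fun n => cR * epsOfRecord ν S.flow.g n) W)
    (U : GaugeField (F.P K) 0 (SU N))
    (hU : IsMinimizerB (avOfRecord F N K) (regMSCoPOfRecord F N ν K k s.Ω) (bd K k s.Ω) W U ∨ U = 1) :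
    ∀ j, 1 ≤ j → j ≤ k → ∀ X : (Sect2.domSys (F.P K) M j).Dom,
      (Sect2.domSites (F.P K) M j X ⊆ s.Λ j →
        Sect2.ofBackgroundC S.ι U ∈
          Sect2.spaceI S (Sect2.Residual.unit (F.P K) (MatA N)) M j (Sect2.domSites (F.P K) M j X) (S.lf.alpha0 (S.flow.g j)) (S.lf.alpha1 (S.flow.g j))) ∧
      (Sect2.admB (F.P K) ν M S.flow.g s.Ω s.Λ j (Sect2.domSites (F.P K) M j X) = true →
        Sect2.ofBackgroundC S.ι U ∈
          Sect2.spaceMS S (Sect2.Residual.unit (F.P K) (MatA N)) M j (Sect2.domSites (F.P K) M j X) s.Ω) := by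
  rcases hU with hmin | rfl
  · exact bgRowAtDatumU_of_thm1RegSepTop7MGB_of_thm1GaugeGB h15 h15G S hι h𝓜 hS hpos ν hM K k cR hnum ha₀ hcomp hcomp' hα hBα htI htMS hC1 hC2 hsN s hsep hM₁
      hadm h7 hmin
  · exact bgRowAtDatum_one S hpos ν M K k s hα

/-- **node00-def-R's COLLAR-CLASS BACKGROUND SATISFIES THE DICHOTOMY TODAY, AT READING (b)'s DATUM, FOR EVERY `𝐖`**: on the solvable set it is the (2.12) minimiser over the class of
record on the `genSet`-fibre (`isMinimizer_UbgMSCoPOfRecord`; `IsMinimizer … 𝔹 = IsMinimizerB … (bondsDet 𝔹)` is F0a, definitional), off it the junk `1`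
(`UbgMSCoPOfRecord_eq_one_of_not_mem`).  After the (iii-b) Stage-2 re-point the same two-line proof over the restated spec inhabits the dichotomy at `lamDatum F`.
[cite: Balaban1988Convergent, (2.12)–(2.13) p.256; Balaban1989LargeFieldI, (1.33) p.183; Balaban1987RG1, (0.1) p.251] -/
theorem ubgMSCoPOfRecord_dichotomy_genSetDatum (ν : Stage7Numerics) (M : ℕ) (g : ℕ → ℝ) (K k : ℕ) (s : SeqOfRecord F ν M g K k) (W : MSField (F.P K) (SU N)) :
    IsMinimizerB (avOfRecord F N K) (regMSCoPOfRecord F N ν K k s.Ω) (genSetDatum F K k s.Ω) W (UbgMSCoPOfRecord F N ν M g K k s W) ∨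
      UbgMSCoPOfRecord F N ν M g K k s W = 1 := by
  by_cases hsol : W ∈ solvableDom (avOfRecord F N K) (regMSCoPOfRecord F N ν K k s.Ω) (genSet s.Ω k)
  · exact Or.inl (isMinimizer_UbgMSCoPOfRecord ν M g K k s hsol)
  · exact Or.inr (UbgMSCoPOfRecord_eq_one_of_not_mem ν M g K k s hsol)

/-- ★ **ROW P11's BODY AT node00-def-R's `UbgMSCoPOfRecord … s 𝐖` FROM THE GUARDED `(bd, Dat)` SENTENCES AT `bd := genSetDatum F`, FOR EVERY DATA PREDICATE `Dat`** —
`Record12BgRowCoClassGaugeRGuarded.bgRowAtDatumCoP_of_thm1RegSepCoP7MG_of_thm1GaugeG` is the further instance `Dat := dataSmall7PTopOf F N` (its sentences by `…_iff_GB`).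
[cite: Balaban1985Variational, Thm 1 (2),(6)–(9) pp.278–279, p.304 lines 1–2; Balaban1988Convergent, (2.6)–(2.8) pp.255–256, (2.12)–(2.13) p.256, (2.27)–(2.28) p.259, (2.34)–(2.41) p.261; Balaban1987RG1, (0.1) p.251, (1.11)–(1.16) p.262] -/
theorem bgRowAtDatumCoP_of_thm1RegSepCoP7MGB_of_thm1GaugeGB_genSetDatum {M : ℕ} {Adm : StepGuard F} {Dat : TopData F N} {B₃ B₃' a₀ a₁ : ℝ}
    (h15 : VariationalThm1RegSepCoP7MGB F N Adm (genSetDatum F) Dat B₃ a₀ a₁) (h15G : VariationalThm1GaugeRegSepCoP7MGB F N M Adm (genSetDatum F) Dat B₃ B₃' a₀ a₁)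
    (S : Sect2.Setting (MatA N) (SU N)) (hι : S.ι = ιSU N) (h𝓜 : S.𝓜 = B12RegularSpaces111SpecialUnitary.suModel N) (hS : S.Laws) (hpos : S.Pos)
    (ν : Stage7Numerics) (hM : 0 < M) (K k : ℕ) (cR : ℝ)
    (hnum : ∀ n, n ≤ k → 0 < cR * epsOfRecord ν S.flow.g n ∧ cR * epsOfRecord ν S.flow.g n ≤ a₁ ∧ B₃ * (cR * epsOfRecord ν S.flow.g n) ≤ ν.εreg)
    (ha₀ : ν.εreg ≤ a₀) (hcomp : ∀ n, n < k → cR * epsOfRecord ν S.flow.g n ≤ 2 * (cR * epsOfRecord ν S.flow.g (n + 1)))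
    (hcomp' : ∀ n, n < k → cR * epsOfRecord ν S.flow.g (n + 1) ≤ 2 * (cR * epsOfRecord ν S.flow.g n))
    (hα : ∀ n, 1 ≤ n → n ≤ k → 0 < S.lf.alpha0 (S.flow.g n) ∧ 0 < S.lf.alpha1 (S.flow.g n))
    (hBα : ∀ n, 1 ≤ n → n ≤ k → B₃ * (cR * epsOfRecord ν S.flow.g n) ≤ (1 - S.βc) * S.lf.alpha0 (S.flow.g n))
    (htI : ∀ n, 1 ≤ n → n ≤ k → B₃' * (cR * epsOfRecord ν S.flow.g n) ≤ S.cB * S.lf.alpha0 (S.flow.g n))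
    (htMS : ∀ n, 1 ≤ n → n ≤ k → B₃' * (cR * epsOfRecord ν S.flow.g n) ≤ S.B * S.C * S.Mr * S.lf.alpha0 (S.flow.g n))
    (hC1 : ∀ j, 1 ≤ j → j ≤ k → ∃ t : ℕ, 0 < t ∧ RkOfRecord (F.P K).L ν.r (S.flow.g j) = (F.P K).L * t)
    (hC2 : ∀ j, 1 ≤ j → j ≤ k → dCubeSide (F.P K).L M (RkOfRecord (F.P K).L ν.r (S.flow.g j)) j ∣ (F.P K).sitesPerDir 0)
    (hsN : ∀ n, 1 ≤ n → n ≤ k + 1 → ((B14.Eq213MaximalDomains.side (F.P K).L M n : ℕ) : ℤ) < (F.P K).sitesPerDir 0)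
    (s : SeqOfRecord F ν M S.flow.g K k) (hsep : Sect2.SeqSeparated ν.M₁ s) (hM₁ : 0 < ν.M₁) (hadm : Adm ν M S.flow.g K k s) (W : MSField (F.P K) (SU N))
    (h7 : Dat K s.Ω (suppDomOfRecord F ν K s.Ω) k (fun n => cR * epsOfRecord ν S.flow.g n) W) :
    ∀ j, 1 ≤ j → j ≤ k → ∀ X : (Sect2.domSys (F.P K) M j).Dom,
      (Sect2.domSites (F.P K) M j X ⊆ s.Λ j →
        Sect2.ofBackgroundC S.ι (UbgMSCoPOfRecord F N ν M S.flow.g K k s W) ∈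
          Sect2.spaceI S (Sect2.Residual.unit (F.P K) (MatA N)) M j (Sect2.domSites (F.P K) M j X) (S.lf.alpha0 (S.flow.g j)) (S.lf.alpha1 (S.flow.g j))) ∧
      (Sect2.admB (F.P K) ν M S.flow.g s.Ω s.Λ j (Sect2.domSites (F.P K) M j X) = true →
        Sect2.ofBackgroundC S.ι (UbgMSCoPOfRecord F N ν M S.flow.g K k s W) ∈
          Sect2.spaceMS S (Sect2.Residual.unit (F.P K) (MatA N)) M j (Sect2.domSites (F.P K) M j X) s.Ω) :=
  bgRowAtDatumBg_of_thm1RegSepCoP7MGB_of_thm1GaugeGB h15 h15G S hι h𝓜 hS hpos ν hM K k cR hnum ha₀ hcomp hcomp' hα hBα htI htMS hC1 hC2 hsN s hsep hM₁ hadm W h7 _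
    (ubgMSCoPOfRecord_dichotomy_genSetDatum ν M S.flow.g K k s W)

end AtRecordGaugeCoPMGB

/-! ## §3  The Stage-13 lift over `(bd, Dat)` with the background's `bd`-spec dichotomy displayed (GaugeRGuarded §5 over `(bd, Dat)`) -/

section LiftGaugeGB

variable {F : T4Family} {N : ℕ} [NeZero N]

/-- **★ ROW P11's BODY AT A STAGE-13 BACKGROUND `Ubg p n s 𝐖` FROM THE GUARDED (8) `VariationalThm1RegSepCoP7MGB … Adm bd Dat …` AND THE GUARDED GAUGE `CoP` SENTENCE
`VariationalThm1GaugeRegSepCoP7MGB … θ.τ9.M Adm bd Dat …`, AT EVERY PREFIX `(p, n, s)` PASSING THE GUARD, FOR DATA SATISFYING `Dat`** — `Record12BgRowCoClassGaugeRGuarded` §5's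
`Stage13Params.bgAtDatumCoP_of_thm1RegSepCoP7MG_of_thm1GaugeG` over `(bd, Dat)` and BACKGROUND-GENERIC: the background map `Ubg` (node00-def-R's `UbgMSCoPOfRecord …` today, the (iii-b)
Stage-2 `UbgMSCoPOfRecordB …` at print's datum tomorrow — `UbgOfRecord₁₃CoP` re-pointed) enters only through the per-prefix dichotomy `hbg` («`bd`-minimiser over the class of record at `𝐖`,
or junk `1`», i.e. its spec at the datum `bd` DISPLAYED); every other letter as there (laws ∕ `Pos` ∕ radii from admissibility, (C2) = `PartCompat₁₃`).  A REDUCTION — the two sentences are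
hypotheses, never asserted; today's instance is ★ below. [cite: Balaban1985Variational, (6)–(7) p.278, Thm 1 (8)–(9) p.279, (152) p.301, Prop. 8 p.304, p.304 lines 1–2; Balaban1985RegularSpaces, (1.3)–(1.9) p.77, Prop. 6 p.99; Balaban1984PropagatorsII, (2.3) p.224; Balaban1988Convergent, Thm 1 p.262, (2.4)–(2.8) pp.255–256, (2.12)–(2.13) p.256, (2.27)–(2.28) p.259, (2.34)–(2.41) p.261; Balaban1987RG1, (0.1) p.251, (1.11)–(1.12) p.262] -/
theorem Stage13Params.bgAtDatumBg_of_thm1RegSepCoP7MGB_of_thm1GaugeGB (θ : Stage13Params F N) (hθ : θ.Admissible F N) (hRz : θ.Rz = RzOfRecord F N)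
    {Adm : StepGuard F} {bd : BondDatum F} {Dat : TopData F N} {B₃ B₃' a₀ a₁ : ℝ} (hM : 0 < θ.τ9.M)
    (h15 : VariationalThm1RegSepCoP7MGB F N Adm bd Dat B₃ a₀ a₁) (h15G : VariationalThm1GaugeRegSepCoP7MGB F N θ.τ9.M Adm bd Dat B₃ B₃' a₀ a₁)
    (Ubg : (p : B12.RunParams) → (n : ℕ) → SeqOfRecord F θ.ν θ.τ9.M (gOfRecord₁₃ F N θ p) p.K n → MSField (F.P p.K) (SU N) → GaugeField (F.P p.K) 0 (SU N))
    (hbg : ∀ (p : B12.RunParams) (n : ℕ) (s : SeqOfRecord F θ.ν θ.τ9.M (gOfRecord₁₃ F N θ p) p.K n) (W : MSField (F.P p.K) (SU N)),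
      IsMinimizerB (avOfRecord F N p.K) (regMSCoPOfRecord F N θ.ν p.K n s.Ω) (bd p.K n s.Ω) W (Ubg p n s W) ∨ Ubg p n s W = 1)
    (hnum : ∀ (p : B12.RunParams) (n : ℕ), n ≤ p.K → Step.InInterval θ.γ n (gOfRecord₁₃ F N θ p) → ∀ m, m ≤ n →
      0 < θ.s2.cR * epsOfRecord θ.ν (gOfRecord₁₃ F N θ p) m ∧ θ.s2.cR * epsOfRecord θ.ν (gOfRecord₁₃ F N θ p) m ≤ a₁ ∧ B₃ * (θ.s2.cR * epsOfRecord θ.ν (gOfRecord₁₃ F N θ p) m) ≤ θ.ν.εreg)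
    (ha₀ : θ.ν.εreg ≤ a₀)
    (hcomp : ∀ (p : B12.RunParams) (n : ℕ), n ≤ p.K → Step.InInterval θ.γ n (gOfRecord₁₃ F N θ p) → ∀ m, m < n →
      θ.s2.cR * epsOfRecord θ.ν (gOfRecord₁₃ F N θ p) m ≤ 2 * (θ.s2.cR * epsOfRecord θ.ν (gOfRecord₁₃ F N θ p) (m + 1)))
    (hcomp' : ∀ (p : B12.RunParams) (n : ℕ), n ≤ p.K → Step.InInterval θ.γ n (gOfRecord₁₃ F N θ p) → ∀ m, m < n →
      θ.s2.cR * epsOfRecord θ.ν (gOfRecord₁₃ F N θ p) (m + 1) ≤ 2 * (θ.s2.cR * epsOfRecord θ.ν (gOfRecord₁₃ F N θ p) m))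
    (hBα : ∀ (p : B12.RunParams) (n : ℕ), n ≤ p.K → Step.InInterval θ.γ n (gOfRecord₁₃ F N θ p) → ∀ m, 1 ≤ m → m ≤ n →
      B₃ * (θ.s2.cR * epsOfRecord θ.ν (gOfRecord₁₃ F N θ p) m) ≤ (1 - θ.s2.βc) * (lfOfRecord₁₂ F N θ.toStage12Params).alpha0 (gOfRecord₁₃ F N θ p m))
    (htI : ∀ (p : B12.RunParams) (n : ℕ), n ≤ p.K → Step.InInterval θ.γ n (gOfRecord₁₃ F N θ p) → ∀ m, 1 ≤ m → m ≤ n →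
      B₃' * (θ.s2.cR * epsOfRecord θ.ν (gOfRecord₁₃ F N θ p) m) ≤ θ.s2.cB * (lfOfRecord₁₂ F N θ.toStage12Params).alpha0 (gOfRecord₁₃ F N θ p m))
    (htMS : ∀ (p : B12.RunParams) (n : ℕ), n ≤ p.K → Step.InInterval θ.γ n (gOfRecord₁₃ F N θ p) → ∀ m, 1 ≤ m → m ≤ n →
      B₃' * (θ.s2.cR * epsOfRecord θ.ν (gOfRecord₁₃ F N θ p) m) ≤ θ.s2.B * θ.s2.C * θ.s2.Mr * (lfOfRecord₁₂ F N θ.toStage12Params).alpha0 (gOfRecord₁₃ F N θ p m))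
    (hC1 : ∀ (p : B12.RunParams) (n : ℕ), n ≤ p.K → Step.InInterval θ.γ n (gOfRecord₁₃ F N θ p) → ∀ j, 1 ≤ j → j ≤ n →
      ∃ t : ℕ, 0 < t ∧ RkOfRecord (F.P p.K).L θ.ν.r (gOfRecord₁₃ F N θ p j) = (F.P p.K).L * t)
    (hsN : ∀ (p : B12.RunParams) (n : ℕ), n ≤ p.K → ∀ n', 1 ≤ n' → n' ≤ n + 1 →
      ((B14.Eq213MaximalDomains.side (F.P p.K).L θ.τ9.M n' : ℕ) : ℤ) < (F.P p.K).sitesPerDir 0) :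
    ∀ (p : B12.RunParams) (n : ℕ), n ≤ p.K → Step.InInterval θ.γ n (gOfRecord₁₃ F N θ p) → PartCompat₁₃ F N θ p n →
      ∀ s : SeqOfRecord F θ.ν θ.τ9.M (gOfRecord₁₃ F N θ p) p.K n, Sect2.SeqSeparated θ.ν.M₁ s → 0 < θ.ν.M₁ →
      Adm θ.ν θ.τ9.M (gOfRecord₁₃ F N θ p) p.K n s → ∀ W : MSField (F.P p.K) (SU N),
      Dat p.K s.Ω (suppDomOfRecord F θ.ν p.K s.Ω) n (fun j => θ.s2.cR * epsOfRecord θ.ν (gOfRecord₁₃ F N θ p) j) W →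
      ∀ j, 1 ≤ j → j ≤ n → ∀ X : (Sect2.domSys (F.P p.K) θ.τ9.M j).Dom,
      (Sect2.domSites (F.P p.K) θ.τ9.M j X ⊆ s.Λ j →
        Sect2.ofBackgroundC (settingOfRecord₁₃ F N θ p).ι (Ubg p n s W) ∈
          Sect2.spaceI (settingOfRecord₁₃ F N θ p) (θ.Rz p.K) θ.τ9.M j (Sect2.domSites (F.P p.K) θ.τ9.M j X)
            ((settingOfRecord₁₃ F N θ p).lf.alpha0 ((settingOfRecord₁₃ F N θ p).flow.g j)) ((settingOfRecord₁₃ F N θ p).lf.alpha1 ((settingOfRecord₁₃ F N θ p).flow.g j))) ∧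
      (Sect2.admB (F.P p.K) θ.ν θ.τ9.M (gOfRecord₁₃ F N θ p) s.Ω s.Λ j (Sect2.domSites (F.P p.K) θ.τ9.M j X) = true →
        Sect2.ofBackgroundC (settingOfRecord₁₃ F N θ p).ι (Ubg p n s W) ∈
          Sect2.spaceMS (settingOfRecord₁₃ F N θ p) (θ.Rz p.K) θ.τ9.M j (Sect2.domSites (F.P p.K) θ.τ9.M j X) s.Ω) := by
  intro p n hn hw hpc s hsep hM₁ hadm W h7
  rw [hRz]
  exact bgRowAtDatumBg_of_thm1RegSepCoP7MGB_of_thm1GaugeGB h15 h15G (settingOfRecord₁₃ F N θ p) rfl rfl (settingOfRecord₁₃_laws F N θ p)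
    (settingOfRecord₁₃_pos F N θ hθ.1.pos p) θ.ν hM p.K n θ.s2.cR (hnum p n hn hw) ha₀ (hcomp p n hn hw) (hcomp' p n hn hw)
    (fun m _ hm => alphaPos₁₃_of_inInterval hθ hw hm) (hBα p n hn hw) (htI p n hn hw) (htMS p n hn hw) (hC1 p n hn hw) hpc (hsN p n hn) s hsep hM₁ hadm W h7 _
    (hbg p n s W)

/-- ★ **TODAY's INSTANCE: the Stage-13 lift at node00-def-R's `UbgMSCoPOfRecord … n s 𝐖` and reading (b)'s datum `genSetDatum F`, `hbg` DISCHARGED (`ubgMSCoPOfRecord_dichotomy_genSetDatum`),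
for every data predicate `Dat`** (`Record12BgRowCoClassGaugeRGuarded` §5 is the further instance `Dat := dataSmall7PTopOf F N`). [cite: Balaban1985Variational, Thm 1 (8)–(9) p.279, Prop. 8 p.304; Balaban1988Convergent, Thm 1 p.262, (2.12)–(2.13) p.256, (2.27)–(2.28) p.259, (2.34)–(2.41) p.261; Balaban1987RG1, (0.1) p.251, (1.11)–(1.12) p.262] -/
theorem Stage13Params.bgAtDatumCoP_of_thm1RegSepCoP7MGB_of_thm1GaugeGB_genSetDatum (θ : Stage13Params F N) (hθ : θ.Admissible F N) (hRz : θ.Rz = RzOfRecord F N)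
    {Adm : StepGuard F} {Dat : TopData F N} {B₃ B₃' a₀ a₁ : ℝ} (hM : 0 < θ.τ9.M)
    (h15 : VariationalThm1RegSepCoP7MGB F N Adm (genSetDatum F) Dat B₃ a₀ a₁) (h15G : VariationalThm1GaugeRegSepCoP7MGB F N θ.τ9.M Adm (genSetDatum F) Dat B₃ B₃' a₀ a₁)
    (hnum : ∀ (p : B12.RunParams) (n : ℕ), n ≤ p.K → Step.InInterval θ.γ n (gOfRecord₁₃ F N θ p) → ∀ m, m ≤ n →
      0 < θ.s2.cR * epsOfRecord θ.ν (gOfRecord₁₃ F N θ p) m ∧ θ.s2.cR * epsOfRecord θ.ν (gOfRecord₁₃ F N θ p) m ≤ a₁ ∧ B₃ * (θ.s2.cR * epsOfRecord θ.ν (gOfRecord₁₃ F N θ p) m) ≤ θ.ν.εreg)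
    (ha₀ : θ.ν.εreg ≤ a₀)
    (hcomp : ∀ (p : B12.RunParams) (n : ℕ), n ≤ p.K → Step.InInterval θ.γ n (gOfRecord₁₃ F N θ p) → ∀ m, m < n →
      θ.s2.cR * epsOfRecord θ.ν (gOfRecord₁₃ F N θ p) m ≤ 2 * (θ.s2.cR * epsOfRecord θ.ν (gOfRecord₁₃ F N θ p) (m + 1)))
    (hcomp' : ∀ (p : B12.RunParams) (n : ℕ), n ≤ p.K → Step.InInterval θ.γ n (gOfRecord₁₃ F N θ p) → ∀ m, m < n →
      θ.s2.cR * epsOfRecord θ.ν (gOfRecord₁₃ F N θ p) (m + 1) ≤ 2 * (θ.s2.cR * epsOfRecord θ.ν (gOfRecord₁₃ F N θ p) m))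
    (hBα : ∀ (p : B12.RunParams) (n : ℕ), n ≤ p.K → Step.InInterval θ.γ n (gOfRecord₁₃ F N θ p) → ∀ m, 1 ≤ m → m ≤ n →
      B₃ * (θ.s2.cR * epsOfRecord θ.ν (gOfRecord₁₃ F N θ p) m) ≤ (1 - θ.s2.βc) * (lfOfRecord₁₂ F N θ.toStage12Params).alpha0 (gOfRecord₁₃ F N θ p m))
    (htI : ∀ (p : B12.RunParams) (n : ℕ), n ≤ p.K → Step.InInterval θ.γ n (gOfRecord₁₃ F N θ p) → ∀ m, 1 ≤ m → m ≤ n →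
      B₃' * (θ.s2.cR * epsOfRecord θ.ν (gOfRecord₁₃ F N θ p) m) ≤ θ.s2.cB * (lfOfRecord₁₂ F N θ.toStage12Params).alpha0 (gOfRecord₁₃ F N θ p m))
    (htMS : ∀ (p : B12.RunParams) (n : ℕ), n ≤ p.K → Step.InInterval θ.γ n (gOfRecord₁₃ F N θ p) → ∀ m, 1 ≤ m → m ≤ n →
      B₃' * (θ.s2.cR * epsOfRecord θ.ν (gOfRecord₁₃ F N θ p) m) ≤ θ.s2.B * θ.s2.C * θ.s2.Mr * (lfOfRecord₁₂ F N θ.toStage12Params).alpha0 (gOfRecord₁₃ F N θ p m))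
    (hC1 : ∀ (p : B12.RunParams) (n : ℕ), n ≤ p.K → Step.InInterval θ.γ n (gOfRecord₁₃ F N θ p) → ∀ j, 1 ≤ j → j ≤ n →
      ∃ t : ℕ, 0 < t ∧ RkOfRecord (F.P p.K).L θ.ν.r (gOfRecord₁₃ F N θ p j) = (F.P p.K).L * t)
    (hsN : ∀ (p : B12.RunParams) (n : ℕ), n ≤ p.K → ∀ n', 1 ≤ n' → n' ≤ n + 1 →
      ((B14.Eq213MaximalDomains.side (F.P p.K).L θ.τ9.M n' : ℕ) : ℤ) < (F.P p.K).sitesPerDir 0) :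
    ∀ (p : B12.RunParams) (n : ℕ), n ≤ p.K → Step.InInterval θ.γ n (gOfRecord₁₃ F N θ p) → PartCompat₁₃ F N θ p n →
      ∀ s : SeqOfRecord F θ.ν θ.τ9.M (gOfRecord₁₃ F N θ p) p.K n, Sect2.SeqSeparated θ.ν.M₁ s → 0 < θ.ν.M₁ →
      Adm θ.ν θ.τ9.M (gOfRecord₁₃ F N θ p) p.K n s → ∀ W : MSField (F.P p.K) (SU N),
      Dat p.K s.Ω (suppDomOfRecord F θ.ν p.K s.Ω) n (fun j => θ.s2.cR * epsOfRecord θ.ν (gOfRecord₁₃ F N θ p) j) W →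
      ∀ j, 1 ≤ j → j ≤ n → ∀ X : (Sect2.domSys (F.P p.K) θ.τ9.M j).Dom,
      (Sect2.domSites (F.P p.K) θ.τ9.M j X ⊆ s.Λ j →
        Sect2.ofBackgroundC (settingOfRecord₁₃ F N θ p).ι (UbgMSCoPOfRecord F N θ.ν θ.τ9.M (gOfRecord₁₃ F N θ p) p.K n s W) ∈
          Sect2.spaceI (settingOfRecord₁₃ F N θ p) (θ.Rz p.K) θ.τ9.M j (Sect2.domSites (F.P p.K) θ.τ9.M j X)
            ((settingOfRecord₁₃ F N θ p).lf.alpha0 ((settingOfRecord₁₃ F N θ p).flow.g j)) ((settingOfRecord₁₃ F N θ p).lf.alpha1 ((settingOfRecord₁₃ F N θ p).flow.g j))) ∧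
      (Sect2.admB (F.P p.K) θ.ν θ.τ9.M (gOfRecord₁₃ F N θ p) s.Ω s.Λ j (Sect2.domSites (F.P p.K) θ.τ9.M j X) = true →
        Sect2.ofBackgroundC (settingOfRecord₁₃ F N θ p).ι (UbgMSCoPOfRecord F N θ.ν θ.τ9.M (gOfRecord₁₃ F N θ p) p.K n s W) ∈
          Sect2.spaceMS (settingOfRecord₁₃ F N θ p) (θ.Rz p.K) θ.τ9.M j (Sect2.domSites (F.P p.K) θ.τ9.M j X) s.Ω) :=
  Stage13Params.bgAtDatumBg_of_thm1RegSepCoP7MGB_of_thm1GaugeGB θ hθ hRz hM h15 h15G (fun p n s W => UbgMSCoPOfRecord F N θ.ν θ.τ9.M (gOfRecord₁₃ F N θ p) p.K n s W)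
    (fun p n s W => ubgMSCoPOfRecord_dichotomy_genSetDatum θ.ν θ.τ9.M (gOfRecord₁₃ F N θ p) p.K n s W) hnum ha₀ hcomp hcomp' hBα htI htMS hC1 hsN

end LiftGaugeGB

end Literature.MathematicalPhysics.QuantumFieldTheory.Balaban1983to89.Node00

end
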